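import Summits.QuantumFields.YangMills.Theorems.BalabanUVNodesN08Thm2AsPrintedAtRecordAC
import Summits.QuantumFields.YangMills.Theorems.BalabanUVNodesN08Thm2AtRecordBridgeInhabited

/-!
# BalabanUVNodes ∕ N08 — [Balaban1985UV3] THEOREM 2 AS PRINTED FOR THE DENSITIES OF THE SLOT OF RECORD'S OWN BINDERS, from the d = 3 lane's (α)-AC rows
# AT PRINT'S OWN AVERAGING (15): the AC external inputs pinned to the record EXIST at `avOfPrint` (cell rule A6), the binders they serve ARE
# `runObjects₀T N 𝔗 (Backgrounds.ofPrint N L) c⋆` at a version `𝔗` of (2), and uniform leaf systems on those towers give `Node00.PrintedUV3V` itself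

Track A, DAG node N08 = T. Bałaban, CMP **102** (1985) 255–275 [Balaban1985UV3]: Thm 2 p. 272 «The sequence of densities ρ_k defined by the inductive equations (2), with
ρ₀ given by (1), satisfies the inequalities (41), (47).», (41) p. 266, (47) p. 267, (1)–(7) pp. 256–257; print's averaging (2) = [Balaban1985Averaging] (15) p. 19, its
Radon–Nikodym class (10) p. 19.  Cell `pub-ymgap`, width seat `pub-ymgap-dag-n08-w1` (g2), W-SEAT-START-LIST §n08 item 1 successor piece (o2) = file 9; `--supports` K1⁷
`StabilityBAtRecordR13SepCoPH` (helper).  Companion of `…N08Thm2AsPrintedAtRecordAC` (file 4: Thm 2 AS PRINTED for the densities of the binders `runObjects₀A N 𝔞_X 𝔗_X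
(Backgrounds.ofAvg N L 𝔞_X) c⋆` along the averaging `𝔞_X` OF ARBITRARY AC external inputs `X` pinned to the record's classes and minimisers, `εbg > 2`) and of
`…N08Thm2AtRecordBridgeInhabited` §2 (`avgAC_avOfPrint`: print's averaging (15) on SU(N) meets the lane's binder `AvgAC` at every level).

WHAT THIS FILE PROVES (kernel; theorems only, 0 def; nothing of the paper asserted).
* §1 TRANSFER TO THE SLOT OF RECORD.  If the averaging family of the inputs IS print's (`𝔞 = avOfPrint N`), the binders `runObjects₀A N 𝔞 𝔗 (Backgrounds.ofAvg N L 𝔞) c`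
  ARE the slot of record's own `runObjects₀T N 𝔗' (Backgrounds.ofPrint N L) c` at a version `𝔗' : Node00.TFamily₃ N L` of (2) — ONE `𝔗'` for every `c`, `S`
  (`exists_TFamily₃_of_av_eq`; `subst` + n08-a's `runObjects₀A_avOfPrint` ∕ `Backgrounds.ofAvg_avOfPrint`, both `rfl`).
* §2 ★ NON-VACUITY (cell rule A6) OF FILE 4's DATA SIDE AT PRINT'S AVERAGING: AC external inputs `X` with `(X S).av = avOfPrint N S`, `(X S).reg k = bgReg3 N S k εbg` and
  `(X S).Uk k = UkA N (avOfPrint N) S (k+1) εbg` EXIST for every `εbg` (`exists_externalInputsAC_ofPrint`; `AvgAC` by `avgAC_avOfPrint`, composite minimisers := `ukAll`,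
  print's history-free idiom).  What is NOT inhabited here: the (α)-AC rows `AlphaAC.RunAlphaAC` at such inputs — N08's object gap in the AC lane's currency.
* §3 ★★ `thm2_asPrinted_at_slotOfRecord` — **THEOREM 2 AS PRINTED FOR THE DENSITIES OF THE SLOT OF RECORD'S OWN BINDERS**: for AC inputs at print's averaging pinned to
  the record (`εbg > 2`), one lattice approximation of the `≤`-family and the (α)-AC rows there, there are a version `𝔗 : TFamily₃ N L` of (2) and tower objects `W` with
  `W.toRunObjects = runObjects₀T N 𝔗 (Backgrounds.ofPrint N L) c⋆ S` — so `W.pin`'s densities ARE `ρ_k = 𝔗^kρ₀` of the slot of record at `c⋆` (`…_rho`) — and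
  (41)_k ∧ (47)_k for every `k ≤ K`; family form `thm2_asPrinted_at_slotOfRecord_family` (ONE `𝔗` for the whole family).  `c⋆ = (eps0Of γ₀, Σ_{j<K}E^{(j)}, lane b₀, p₀,
  εbg)` is admissible (file 4's `constsAC_adm`); its level-0 window condition of file 8 holds trivially (`εbg > 2`: `windowExact_consts_of_AC`).
* §4 ★★ THE UPGRADE, AT THE SLOT OF RECORD: uniform leaf systems (`B10Assembly.LeafSystem C`, ONE `C`) on the lane's AC towers `towerOfAC 𝔠.lane (X S) (𝔖 S)` at print's
  averaging over the record's family give **`Node00.PrintedUV3V N L` ITSELF** (`printedUV3V_of_leafSystems_AC_ofPrint`; the (α) rows are then not even needed — a leaf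
  system carries (41)∕(47) through Sect. D).  This is the exact object N08's `h08` reads, stated in the AC lane's currency at print's own averaging (no E6′ seam: `AvgAC` only).

HONEST FRAMING: count-neutral helper; N08 NOT discharged; the (α)-AC rows and the leaf systems are HYPOTHESES (N08's object gap, class II of n08-b's census) — LOCATED
sockets whose data side this file inhabits; `PrintedUV3V` NOT proved; one finite 𝕋⁴ programme at fixed ε, Bałaban AS PRINTED (d = 3 tori of [B10] inside the record) — R4
closes the conditional finite-𝕋⁴ rung `BalabanLadder.UV` only; the Yang–Mills mass gap (Clay) is NOT proved by any of this; nothing continuum ∕ ℝ⁴ ∕ OS.  No `sorry`,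
standard axioms.
-/

noncomputable section

namespace Summit.QuantumFields.YangMills.BalabanUVNodes.N08Thm2AsPrintedAtSlotOfRecordAC

open Literature.MathematicalPhysics.QuantumFieldTheory.Balaban1983to89
open Literature.MathematicalPhysics.QuantumFieldTheory.Balaban1983to89.Node00 (SU TFamily₃ AvgFamily₃ TFamilyA₃)
open Literature.MathematicalPhysics.QuantumFieldTheory.Balaban1983to89.B10RunsOfRecord
open Literature.MathematicalPhysics.QuantumFieldTheory.Balaban1985CMP102
open Literature.MathematicalPhysics.QuantumFieldTheory.Balaban1985CMP102.Setting
open Literature.MathematicalPhysics.QuantumFieldTheory.Balaban1985CMP102.Theorems (Family)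
open Summit.QuantumFields.Balaban3D
open Summit.QuantumFields.Balaban3D.Carriers (nblkOf StepSeries)
open Summit.QuantumFields.Balaban3D.Proofs
open Summit.QuantumFields.Balaban3D.Proofs.GroupModelLieC (lieC)
open Summit.QuantumFields.Balaban3D.Proofs.Constants (eps0Of)
open Summit.QuantumFields.YangMills.BalabanUVNodes.N08Thm2AtRecordLevelZero
open Summit.QuantumFields.YangMills.BalabanUVNodes.N08Thm2AtRecordSeamK0
open Summit.QuantumFields.YangMills.BalabanUVNodes.N08Thm2AtRecordBridgeInhabited
open Summit.QuantumFields.YangMills.BalabanUVNodes.N08Thm2AsPrintedAtRecordAC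

variable {N : ℕ} [NeZero N] {L : ℕ}

/-! ## §1 Transfer: binders along print's averaging ARE the slot of record's binders at a version of (2) -/
section Transfer

/-- ★ **If the averaging family IS print's, the binders `runObjects₀A N 𝔞 𝔗 (Backgrounds.ofAvg N L 𝔞) c S` ARE the slot of record's own `runObjects₀T N 𝔗'
(Backgrounds.ofPrint N L) c S`** at ONE version `𝔗' : TFamily₃ N L` of (2) (for all `c`, `S`): `subst 𝔞`, then n08-a's `runObjects₀A_avOfPrint` ∕ `Backgrounds.ofAvg_avOfPrint`
(`rfl`). [cite: Balaban1985UV3, (2) + (5) p.256 (the binders; bookkeeping); Balaban1985Averaging, (15) p.19] -/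
theorem exists_TFamily₃_of_av_eq {𝔞 : AvgFamily₃ N L} (h𝔞 : 𝔞 = avOfPrint N) (𝔗 : TFamilyA₃ N 𝔞) :
    ∃ 𝔗' : TFamily₃ N L, ∀ (c : Consts L) (S : Scales L),
      runObjects₀A N 𝔞 𝔗 (Backgrounds.ofAvg N L 𝔞) c S = runObjects₀T N 𝔗' (Backgrounds.ofPrint N L) c S := by
  subst h𝔞
  exact ⟨𝔗, fun _ _ => rfl⟩

/-- The same for ONE run-objects equation (the form file 4's theorems produce). [cite: Balaban1985UV3, (2) + (5) p.256 (bookkeeping)] -/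
theorem exists_TFamily₃_of_av_eq' {𝔞 : AvgFamily₃ N L} (h𝔞 : 𝔞 = avOfPrint N) (𝔗 : TFamilyA₃ N 𝔞) {c : Consts L} {S : Scales L}
    {R : RunObjects S (SU N)} (hR : R = runObjects₀A N 𝔞 𝔗 (Backgrounds.ofAvg N L 𝔞) c S) :
    ∃ 𝔗' : TFamily₃ N L, R = runObjects₀T N 𝔗' (Backgrounds.ofPrint N L) c S := by
  obtain ⟨𝔗', h⟩ := exists_TFamily₃_of_av_eq h𝔞 𝔗
  exact ⟨𝔗', hR.trans (h c S)⟩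

end Transfer

/-! ## §2 Non-vacuity: AC external inputs AT PRINT'S AVERAGING pinned to the record's classes and minimisers exist -/
section Inhabited

variable (N L)

/-- ★ **NON-VACUITY (A6) OF FILE 4's DATA SIDE AT PRINT'S OWN AVERAGING**: for every class radius `εbg` there are AC external inputs `X` with `(X S).av = avOfPrint N S`
(`AvgAC` from `avgAC_avOfPrint`: measurability + `Ū_*(dU) ≪ dV` of (15) on SU(N)), the record's classes `bgReg3 … εbg` and [7]-minimisers `UkA … (k+1) εbg` along print's
averaging, and history-free composite minimisers `ukAll` (print's (42) at the trivial history by `rfl`). [cite: Balaban1985UV3, (5) p.256 + (42) p.266 (bookkeeping); Balaban1985Averaging, (15) p.19] -/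
theorem exists_externalInputsAC_ofPrint (εbg : ℝ) :
    ∃ X : ∀ S : Scales L, StandardAC.ExternalInputsAC S (SU N),
      (∀ S, (X S).av = avOfPrint N S) ∧ (∀ S k, (X S).reg k = bgReg3 N S k εbg) ∧
        ∀ (S : Scales L) k (V : GaugeField S.P (k + 1) (SU N)), (X S).Uk k V = UkA N (fun S => (X S).av) S (k + 1) εbg V :=
  ⟨fun S =>
    { av := avOfPrint N S
      av_ac := avgAC_avOfPrint N L S
      reg := fun k => bgReg3 N S k εbg
      Uk := fun k V => UkA N (avOfPrint N) S (k + 1) εbg V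
      UkH := fun k _ V => Carriers.ukAll (fun k V => UkA N (avOfPrint N) S (k + 1) εbg V) k V
      UkH_triv := fun _ _ => rfl },
    fun _ => rfl, fun _ _ => rfl, fun _ _ _ => rfl⟩

end Inhabited

/-! ## §3 THEOREM 2 AS PRINTED for the densities of the SLOT OF RECORD's own binders, from the (α)-AC rows at print's averaging -/
section Thm2

variable {𝔊 : GroupModel (SU N)} {𝔠 : Primitives.AlphaConsts L 𝔊.N} {εbg : ℝ}
  {X : ∀ S : Scales L, StandardAC.ExternalInputsAC S (SU N)}
  {𝔖 : ∀ (S : Scales L) (k : ℕ), StepSeries S (SU N) ↥(lieC 𝔊) (nblkOf S 𝔠.lane.carrier k) k}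
  {𝔄 : ∀ S : Scales L, AlphaAC.AlphaDataAC 𝔊 𝔠 (X S) (𝔖 S)}

/-- ★★ **[Balaban1985UV3] THEOREM 2 AS PRINTED FOR THE DENSITIES OF THE SLOT OF RECORD'S OWN BINDERS** — AC external inputs AT PRINT'S AVERAGING (`(X S).av = avOfPrint N S`)
with the record's classes and minimisers, `εbg > 2`, one lattice approximation of the `≤`-family `g²ε₀ ≤ (min γ₀ 1)²`, the (α)-AC rows there: there are a version `𝔗` of (2)
along print's averaging and tower objects `W` EXTENDING `runObjects₀T N 𝔗 (Backgrounds.ofPrint N L) c⋆ S` with (41)_k ∧ (47)_k for every `k ≤ K` (file 4's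
`thm2_asPrinted_at_record_binders` transferred by §1). [cite: Balaban1985UV3, Thm 2 p.272 + (41) p.266 + (47) p.267; Balaban1985Averaging, (15) p.19] -/
theorem thm2_asPrinted_at_slotOfRecord (hε : 2 < εbg) (hav : ∀ S, (X S).av = avOfPrint N S) (hreg : ∀ (S : Scales L) k, (X S).reg k = bgReg3 N S k εbg)
    (hUk : ∀ (S : Scales L) k (V : GaugeField S.P (k + 1) (SU N)), (X S).Uk k V = UkA N (fun S => (X S).av) S (k + 1) εbg V)
    {S : Scales L} (hle : S.g ^ 2 * S.ε₀ ≤ (min 𝔠.gamma0 1) ^ 2) (R : AlphaAC.RunAlphaAC 𝔊 𝔠 (X S) (𝔖 S) (𝔄 S)) :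
    ∃ (𝔗 : TFamily₃ N L) (W : SectB.TowerObjects S (SU N)),
      W.toRunObjects = runObjects₀T N 𝔗 (Backgrounds.ofPrint N L)
        { eps0 := eps0Of 𝔠.gamma0, E := fun S => B10.Ek (InputsAC.inputOfAC 𝔠.lane (X S) (𝔖 S)).Estep S.K 0,
          b₀ := 𝔠.lane.F.b₀, p₀ := 𝔠.lane.F.p₀, εbg := εbg } S ∧
      ∀ k, k ≤ S.K → B10.Ineq41 W.pin.toTowerRun k ∧ B10.Ineq47 W.pin.toTowerRun k := by
  obtain ⟨W, hW, h⟩ := thm2_asPrinted_at_record_binders (𝔄 := 𝔄) hε hreg hUk hle R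
  obtain ⟨𝔗', h'⟩ := exists_TFamily₃_of_av_eq' (funext hav) _ hW
  exact ⟨𝔗', W, h', h⟩

/-- **… and `W.pin`'s densities ARE the slot of record's `ρ_k = 𝔗^kρ₀` at `c⋆`** ((2): `pin` does not touch `ρ_k`, `SectB.TowerObjects.pin_rho`). [cite: Balaban1985UV3, (2) p.256 + Thm 2 p.272] -/
theorem thm2_asPrinted_at_slotOfRecord_rho (hε : 2 < εbg) (hav : ∀ S, (X S).av = avOfPrint N S) (hreg : ∀ (S : Scales L) k, (X S).reg k = bgReg3 N S k εbg)
    (hUk : ∀ (S : Scales L) k (V : GaugeField S.P (k + 1) (SU N)), (X S).Uk k V = UkA N (fun S => (X S).av) S (k + 1) εbg V)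
    {S : Scales L} (hle : S.g ^ 2 * S.ε₀ ≤ (min 𝔠.gamma0 1) ^ 2) (R : AlphaAC.RunAlphaAC 𝔊 𝔠 (X S) (𝔖 S) (𝔄 S)) :
    ∃ (𝔗 : TFamily₃ N L) (W : SectB.TowerObjects S (SU N)),
      (∀ k, W.pin.rho k = (runObjects₀T N 𝔗 (Backgrounds.ofPrint N L)
        { eps0 := eps0Of 𝔠.gamma0, E := fun S => B10.Ek (InputsAC.inputOfAC 𝔠.lane (X S) (𝔖 S)).Estep S.K 0,
          b₀ := 𝔠.lane.F.b₀, p₀ := 𝔠.lane.F.p₀, εbg := εbg } S).rho k) ∧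
      ∀ k, k ≤ S.K → B10.Ineq41 W.pin.toTowerRun k ∧ B10.Ineq47 W.pin.toTowerRun k := by
  obtain ⟨𝔗, W, hW, h⟩ := thm2_asPrinted_at_slotOfRecord (𝔄 := 𝔄) hε hav hreg hUk hle R
  refine ⟨𝔗, W, fun k => ?_, h⟩
  rw [SectB.TowerObjects.pin_rho, ← hW]

/-- ★★ **FAMILY FORM — print's Theorem 2 for the densities of the slot of record's binders at EVERY member of `Family L c⋆.eps0`, ONE version `𝔗` of (2) for the whole
family** (`c⋆.eps0 = eps0Of γ₀`; each member lies on the `≤`-family, `FamilyLE.le_of_eps0Of`). [cite: Balaban1985UV3, Thm 2 p.272 + p.256 L15–18] -/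
theorem thm2_asPrinted_at_slotOfRecord_family (hε : 2 < εbg) (hav : ∀ S, (X S).av = avOfPrint N S)
    (hreg : ∀ (S : Scales L) k, (X S).reg k = bgReg3 N S k εbg)
    (hUk : ∀ (S : Scales L) k (V : GaugeField S.P (k + 1) (SU N)), (X S).Uk k V = UkA N (fun S => (X S).av) S (k + 1) εbg V)
    (R : ∀ S : Family L (eps0Of 𝔠.gamma0), AlphaAC.RunAlphaAC 𝔊 𝔠 (X S.1) (𝔖 S.1) (𝔄 S.1)) :
    ∃ 𝔗 : TFamily₃ N L, ∀ S : Family L (eps0Of 𝔠.gamma0), ∃ W : SectB.TowerObjects S.1 (SU N),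
      W.toRunObjects = runObjects₀T N 𝔗 (Backgrounds.ofPrint N L)
        { eps0 := eps0Of 𝔠.gamma0, E := fun S => B10.Ek (InputsAC.inputOfAC 𝔠.lane (X S) (𝔖 S)).Estep S.K 0,
          b₀ := 𝔠.lane.F.b₀, p₀ := 𝔠.lane.F.p₀, εbg := εbg } S.1 ∧
      ∀ k, k ≤ S.1.K → B10.Ineq41 W.pin.toTowerRun k ∧ B10.Ineq47 W.pin.toTowerRun k := by
  obtain ⟨𝔗', h'⟩ := exists_TFamily₃_of_av_eq (N := N) (funext hav)
    (fun S j => (Carriers.run3 ((InputsAC.inputOfAC 𝔠.lane (X S) (𝔖 S)).toRunInput fun _ => True)).T j)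
  refine ⟨𝔗', fun S => ?_⟩
  obtain ⟨W, hW, h⟩ := thm2_asPrinted_at_record_binders (𝔄 := 𝔄) hε hreg hUk (FamilyLE.le_of_eps0Of S.1 S.2) (R S)
  exact ⟨W, hW.trans (h' _ S.1), h⟩

/-- The constants `c⋆` the lane's AC input serves have `εbg > 2`, so **file 8's EXACT level-0 condition holds for them at every lattice approximation** (the trivial branch;
consistency of files 4∕8∕9). [cite: Balaban1985UV3, (47) p.267 + (7) p.257 (bookkeeping)] -/
theorem windowExact_consts_of_AC (hε : 2 < εbg) (E : Scales L → ℝ) (S : Scales L) :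
    eps1OfPrint ({ eps0 := eps0Of 𝔠.gamma0, E := E, b₀ := 𝔠.lane.F.b₀, p₀ := 𝔠.lane.F.p₀, εbg := εbg } : Consts L) S 0 ≤ εbg ∨ 2 < εbg :=
  Or.inr hε

end Thm2

/-! ## §4 The upgrade at the slot of record: uniform leaf systems on the AC towers at print's averaging give `PrintedUV3V` itself -/
section Upgrade

variable {𝔊 : GroupModel (SU N)} {𝔠 : Primitives.AlphaConsts L 𝔊.N} {εbg : ℝ}
  {X : ∀ S : Scales L, StandardAC.ExternalInputsAC S (SU N)}
  {𝔖 : ∀ (S : Scales L) (k : ℕ), StepSeries S (SU N) ↥(lieC 𝔊) (nblkOf S 𝔠.lane.carrier k) k}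

/-- **A leaf system on the AC tower at print's averaging IS a per-run datum OF THE SLOT OF RECORD** (`Repr41_47G N (runObjects₀T N 𝔗 (Backgrounds.ofPrint N L)) c⋆ S k`,
every `k ≤ K`, at the version `𝔗` of §1). [cite: Balaban1985UV3, Thm 2 p.272 + Sect. D pp.272–275] -/
theorem repr41_47G_slotOfRecord_of_leafSystem_AC (hε : 2 < εbg) (hav : ∀ S, (X S).av = avOfPrint N S)
    (hreg : ∀ (S : Scales L) k, (X S).reg k = bgReg3 N S k εbg)
    (hUk : ∀ (S : Scales L) k (V : GaugeField S.P (k + 1) (SU N)), (X S).Uk k V = UkA N (fun S => (X S).av) S (k + 1) εbg V) :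
    ∃ 𝔗 : TFamily₃ N L, ∀ {S : Scales L} {C : B10Assembly.Consts}
      (_ : B10Assembly.LeafSystem C (InputsAC.towerOfAC 𝔠.lane (X S) (𝔖 S))) (k : ℕ), k ≤ S.K →
      Repr41_47G N (runObjects₀T N 𝔗 (Backgrounds.ofPrint N L))
        { eps0 := eps0Of 𝔠.gamma0, E := fun S => B10.Ek (InputsAC.inputOfAC 𝔠.lane (X S) (𝔖 S)).Estep S.K 0,
          b₀ := 𝔠.lane.F.b₀, p₀ := 𝔠.lane.F.p₀, εbg := εbg } S k := by
  obtain ⟨𝔗', h'⟩ := exists_TFamily₃_of_av_eq (N := N) (funext hav)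
    (fun S j => (Carriers.run3 ((InputsAC.inputOfAC 𝔠.lane (X S) (𝔖 S)).toRunInput fun _ => True)).T j)
  refine ⟨𝔗', fun {S} {C} LS k hk => ?_⟩
  exact Theorems.BalabanUVNodesN08RelativeTo5.repr41_47G_of_leafSystem N _ _ ((InputsAC.inputOfAC 𝔠.lane (X S) (𝔖 S)).towerWith fun _ => True)
    ((inputOfAC_extends_record 𝔠 εbg X 𝔖 hε hreg hUk S).trans (h' _ S)) LS k hk

/-- ★★ **`Node00.PrintedUV3V N L` — THE [B10] SLOT OF RECORD ITSELF — FROM UNIFORM LEAF SYSTEMS ON THE LANE'S AC TOWERS AT PRINT'S OWN AVERAGING**, pinned to the record's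
classes and minimisers (`εbg > 2`; ONE `B10Assembly.Consts` for the family `Family L c⋆.eps0` — Thm 1's «O(1) independent of ε, k»): ∃-introduction on the version `𝔗` of §1
and on `c⋆` (admissible, `constsAC_adm`), through n08-a's `printedUV3G_of_uniformLeafSystems`.  The leaf systems are the HYPOTHESIS (N08's object gap); the (α) rows
are not needed on this road (a leaf system carries (41)∕(47) through Sect. D). [cite: Balaban1985UV3, Thm 1 p.257 + Thm 2 p.272 + pp.256–274 (the leaves); Balaban1985Averaging, (15) p.19] -/
theorem printedUV3V_of_leafSystems_AC_ofPrint (hε : 2 < εbg) (hav : ∀ S, (X S).av = avOfPrint N S)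
    (hreg : ∀ (S : Scales L) k, (X S).reg k = bgReg3 N S k εbg)
    (hUk : ∀ (S : Scales L) k (V : GaugeField S.P (k + 1) (SU N)), (X S).Uk k V = UkA N (fun S => (X S).av) S (k + 1) εbg V)
    {C : B10Assembly.Consts}
    (LS : ∀ S : Family L (eps0Of 𝔠.gamma0), B10Assembly.LeafSystem C (InputsAC.towerOfAC 𝔠.lane (X S.1) (𝔖 S.1))) :
    Node00.PrintedUV3V N L := by
  obtain ⟨𝔗', h'⟩ := exists_TFamily₃_of_av_eq (N := N) (funext hav)
    (fun S j => (Carriers.run3 ((InputsAC.inputOfAC 𝔠.lane (X S) (𝔖 S)).toRunInput fun _ => True)).T j)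
  refine ⟨𝔗', printedUV3G_of_uniformLeafSystems N L _
    ⟨{ eps0 := eps0Of 𝔠.gamma0, E := fun S => B10.Ek (InputsAC.inputOfAC 𝔠.lane (X S) (𝔖 S)).Estep S.K 0,
       b₀ := 𝔠.lane.F.b₀, p₀ := 𝔠.lane.F.p₀, εbg := εbg }, constsAC_adm 𝔠 εbg hε _, C, fun S => ?_⟩⟩
  exact ⟨(InputsAC.inputOfAC 𝔠.lane (X S.1) (𝔖 S.1)).towerWith fun _ => True,
    (inputOfAC_extends_record 𝔠 εbg X 𝔖 hε hreg hUk S.1).trans (h' _ S.1), ⟨LS S⟩⟩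

/-- **… in particular along the A6 inhabitant of §2** (any `εbg > 2`): uniform leaf systems on the AC towers over THOSE inputs give the slot of record.  The form a supplier reads:
«produce `LeafSystem C` on `towerOfAC 𝔠.lane (X S) (𝔖 S)` for the print-averaging inputs `X` and your step series `𝔖`, uniformly on the family». [cite: Balaban1985UV3, Thm 1 p.257 + Thm 2 p.272] -/
theorem printedUV3V_of_leafSystems_AC_ofPrint' (hε : 2 < εbg) :
    ∃ X : ∀ S : Scales L, StandardAC.ExternalInputsAC S (SU N), (∀ S, (X S).av = avOfPrint N S) ∧
      ∀ (𝔖 : ∀ (S : Scales L) (k : ℕ), StepSeries S (SU N) ↥(lieC 𝔊) (nblkOf S 𝔠.lane.carrier k) k) (C : B10Assembly.Consts),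
        (∀ S : Family L (eps0Of 𝔠.gamma0), B10Assembly.LeafSystem C (InputsAC.towerOfAC 𝔠.lane (X S.1) (𝔖 S.1))) → Node00.PrintedUV3V N L := by
  obtain ⟨X, hav, hreg, hUk⟩ := exists_externalInputsAC_ofPrint N L εbg
  exact ⟨X, hav, fun 𝔖 C LS => printedUV3V_of_leafSystems_AC_ofPrint (𝔖 := 𝔖) hε hav hreg hUk LS⟩

end Upgrade

end Summit.QuantumFields.YangMills.BalabanUVNodes.N08Thm2AsPrintedAtSlotOfRecordAC

end
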